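import Mathlib
import Summits.Ventures.PercRepro.TriangleCapBipartiteDeficit
import Summits.Ventures.PercRepro.TriangleCapOneBelowDiagonal

/-!
# PercRepro — the bipartite sub-problem with fixed parts, part A: the missing-pair count and the star witness
`K_{a,n−a}` minus `r` edges at one vertex (p3, gen 34; part 36a)

`sum_deg_left_eq_card_edges` / `card_missing_add_card_edges`: on a bipartite spanning graph with parts `X`, `Xᶜ`
the missing cross pairs and the edges add up to `|X|·|Xᶜ|`.  `bipMinusStar n a r` is `K_{a,n−a}` on `Fin n` minus
the `r` edges from the left vertex `0` to the right vertices `a, …, a + r − 1` (`rightStar n a r`, `r` vertices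
when `a + r ≤ n`); it is bipartite with left part `{i : i < a}` (`bipMinusStar_bipartite`) and its degrees are
`n − a − r` at `0`, `a − 1` on the star, those of `K_{a,n−a}` elsewhere (`deg_bipMinusStar`).  Axioms: standard.
-/

namespace PercRepro

namespace TriangleCap

namespace C047

open Finset

variable {V : Type*} [Fintype V] [DecidableEq V]

/-- `Σ_{x ∈ X} d(x) = m` on a bipartite spanning graph with parts `X`, `Xᶜ`. -/
theorem sum_deg_left_eq_card_edges (D : SimpleGraph V) [DecidableRel D.Adj] (X : Finset V)
    (hbip : ∀ x y, D.Adj x y → (x ∈ X ↔ y ∉ X)) :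
    ∑ x ∈ X, deg D x = D.edgeFinset.card := by
  have h1 : ∑ x ∈ X, deg D x = ((X ×ˢ Xᶜ).filter (fun p => D.Adj p.1 p.2)).card := by
    rw [card_filter, sum_product]
    apply sum_congr rfl
    intro x hx
    dsimp only
    unfold deg
    have e : (univ : Finset V).filter (fun w => D.Adj x w) = Xᶜ.filter (fun w => D.Adj x w) := by
      ext w
      simp only [mem_filter, mem_univ, true_and, mem_compl]
      exact ⟨fun h => ⟨(hbip x w h).mp hx, h⟩, fun h => h.2⟩
    rw [e, card_filter]
  have h2 : ∑ y ∈ Xᶜ, deg D y = ((Xᶜ ×ˢ X).filter (fun p => D.Adj p.1 p.2)).card := by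
    rw [card_filter, sum_product]
    apply sum_congr rfl
    intro y hy
    rw [mem_compl] at hy
    dsimp only
    unfold deg
    have e : (univ : Finset V).filter (fun w => D.Adj y w) = X.filter (fun w => D.Adj y w) := by
      ext w
      simp only [mem_filter, mem_univ, true_and]
      refine ⟨fun h => ⟨?_, h⟩, fun h => h.2⟩
      by_contra hw
      exact hy ((hbip y w h).mpr hw)
    rw [e, card_filter]
  have h3 : ((Xᶜ ×ˢ X).filter (fun p => D.Adj p.1 p.2)).card =
      ((X ×ˢ Xᶜ).filter (fun p => D.Adj p.1 p.2)).card := by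
    have e : (Xᶜ ×ˢ X).filter (fun p => D.Adj p.1 p.2) =
        ((X ×ˢ Xᶜ).filter (fun p => D.Adj p.1 p.2)).image Prod.swap := by
      ext p
      simp only [mem_filter, mem_product, mem_image]
      constructor
      · rintro ⟨⟨h1, h2⟩, h3⟩
        exact ⟨p.swap, ⟨⟨h2, h1⟩, h3.symm⟩, Prod.swap_swap p⟩
      · rintro ⟨q, ⟨⟨h1, h2⟩, h3⟩, rfl⟩
        exact ⟨⟨h2, h1⟩, h3.symm⟩
    rw [e, card_image_of_injective _ Prod.swap_injective]
  have h4 := sum_add_sum_compl X (deg D)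
  rw [sum_deg_eq] at h4
  omega

/-- `N₀ + m = |X|·|Xᶜ|` on a bipartite spanning graph with parts `X`, `Xᶜ`. -/
theorem card_missing_add_card_edges (D : SimpleGraph V) [DecidableRel D.Adj] (X : Finset V)
    (hbip : ∀ x y, D.Adj x y → (x ∈ X ↔ y ∉ X)) :
    (missing D X Xᶜ).card + D.edgeFinset.card = X.card * Xᶜ.card := by
  rw [card_missing_left, ← sum_deg_left_eq_card_edges D X hbip, ← sum_add_distrib]
  have e : ∀ x ∈ X, miss D Xᶜ x + deg D x = Xᶜ.card := by
    intro x hx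
    unfold miss deg
    have e2 : (univ : Finset V).filter (fun w => D.Adj x w) = Xᶜ.filter (fun w => D.Adj x w) := by
      ext w
      simp only [mem_filter, mem_univ, true_and, mem_compl]
      exact ⟨fun h => ⟨(hbip x w h).mp hx, h⟩, fun h => h.2⟩
    rw [e2]
    have := card_filter_add_card_filter_not (s := Xᶜ) (fun w => D.Adj x w)
    omega
  rw [sum_congr rfl e, sum_const, smul_eq_mul]

/-- `K_{a, n−a}` on `Fin n` minus the `r` edges from the left vertex `0` to the right vertices `a, …, a + r − 1`. -/
def bipMinusStar (n a r : ℕ) : SimpleGraph (Fin n) where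
  Adj i j := Xor (i.val < a) (j.val < a) ∧
    ¬ ((i.val = 0 ∧ a ≤ j.val ∧ j.val < a + r) ∨ (j.val = 0 ∧ a ≤ i.val ∧ i.val < a + r))
  symm := ⟨fun i j h => by
    obtain ⟨h1, h2⟩ := h
    refine ⟨?_, fun h' => h2 ?_⟩
    · rcases h1 with ⟨ha, hb⟩ | ⟨ha, hb⟩
      · exact Or.inr ⟨ha, hb⟩
      · exact Or.inl ⟨ha, hb⟩
    · rcases h' with h' | h'
      · exact Or.inr h'
      · exact Or.inl h'⟩
  loopless := ⟨fun i h => by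
    rcases h.1 with ⟨h1, h2⟩ | ⟨h1, h2⟩ <;> exact h2 h1⟩

/-- Adjacency in `bipMinusStar n a r` is decidable. -/
instance decidableRelBipMinusStar (n a r : ℕ) : DecidableRel (bipMinusStar n a r).Adj :=
  fun i j => inferInstanceAs (Decidable (Xor (i.val < a) (j.val < a) ∧
    ¬ ((i.val = 0 ∧ a ≤ j.val ∧ j.val < a + r) ∨ (j.val = 0 ∧ a ≤ i.val ∧ i.val < a + r))))

/-- Adjacency in `bipMinusStar n a r`. -/
theorem bipMinusStar_adj (n a r : ℕ) (i j : Fin n) : (bipMinusStar n a r).Adj i j ↔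
    Xor (i.val < a) (j.val < a) ∧
      ¬ ((i.val = 0 ∧ a ≤ j.val ∧ j.val < a + r) ∨ (j.val = 0 ∧ a ≤ i.val ∧ i.val < a + r)) := Iff.rfl

/-- `bipMinusStar n a r` is bipartite with left part `{i : i < a}`. -/
theorem bipMinusStar_bipartite (n a r : ℕ) (x y : Fin n) (h : (bipMinusStar n a r).Adj x y) :
    x ∈ univ.filter (fun i : Fin n => i.val < a) ↔ y ∉ univ.filter (fun i : Fin n => i.val < a) := by
  simp only [mem_filter, mem_univ, true_and]
  rcases h.1 with ⟨h1, h2⟩ | ⟨h1, h2⟩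
  · exact ⟨fun _ => h2, fun _ => h1⟩
  · exact ⟨fun h => absurd h h2, fun h => absurd h1 h⟩

/-- The right vertices `a, …, a + r − 1`. -/
def rightStar (n a r : ℕ) : Finset (Fin n) := univ.filter (fun j : Fin n => a ≤ j.val ∧ j.val < a + r)

/-- `|rightStar| = r` when `a + r ≤ n`. -/
theorem card_rightStar (n a r : ℕ) (h : a + r ≤ n) : (rightStar n a r).card = r := by
  have e : rightStar n a r = (univ.filter (fun j : Fin n => j.val < a + r)).filter
      (fun j : Fin n => ¬ j.val < a) := by
    ext j
    simp only [rightStar, mem_filter, mem_univ, true_and]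
    omega
  have h1 := card_filter_add_card_filter_not (s := univ.filter (fun j : Fin n => j.val < a + r))
    (fun j : Fin n => j.val < a)
  have e2 : (univ.filter (fun j : Fin n => j.val < a + r)).filter (fun j : Fin n => j.val < a) =
      univ.filter (fun j : Fin n => j.val < a) := by
    ext j
    simp only [mem_filter, mem_univ, true_and]
    omega
  rw [e2, card_left n a (by omega), card_left n (a + r) h] at h1
  rw [e]
  omega

/-- The neighbourhood of a vertex other than `0` and the star's right vertices is unchanged. -/
theorem filter_adj_bipMinusStar_of_ne (n a r : ℕ) (v : Fin n) (h0 : v.val ≠ 0)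
    (hv : v ∉ rightStar n a r) :
    univ.filter (fun w => (bipMinusStar n a r).Adj v w) = univ.filter (fun w => (bip n a).Adj v w) := by
  simp only [rightStar, mem_filter, mem_univ, true_and] at hv
  apply filter_congr
  intro w _
  rw [bipMinusStar_adj, bip_adj]
  constructor
  · exact fun h => h.1
  · intro h
    refine ⟨h, fun h' => ?_⟩
    rcases h' with ⟨h1, _⟩ | ⟨_, h2, h3⟩
    · exact h0 h1
    · exact hv ⟨h2, h3⟩

/-- The neighbourhood of the left vertex `0` loses the star's right vertices. -/
theorem filter_adj_bipMinusStar_zero (n a r : ℕ) (ha : 1 ≤ a) (v : Fin n) (hv : v.val = 0) :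
    univ.filter (fun w => (bipMinusStar n a r).Adj v w) =
      (univ.filter (fun w => (bip n a).Adj v w)) \ rightStar n a r := by
  ext w
  simp only [mem_sdiff, mem_filter, mem_univ, true_and, rightStar, bipMinusStar_adj, bip_adj]
  constructor
  · rintro ⟨h1, h2⟩
    exact ⟨h1, fun h3 => h2 (Or.inl ⟨hv, h3⟩)⟩
  · rintro ⟨h1, h2⟩
    refine ⟨h1, fun h => ?_⟩
    rcases h with ⟨_, h3⟩ | ⟨_, h3, _⟩
    · exact h2 h3
    · omega

/-- The neighbourhood of a star vertex loses `0`. -/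
theorem filter_adj_bipMinusStar_star (n a r : ℕ) (ha : 1 ≤ a) (hn : 0 < n) (v : Fin n)
    (hv : v ∈ rightStar n a r) :
    univ.filter (fun w => (bipMinusStar n a r).Adj v w) =
      (univ.filter (fun w => (bip n a).Adj v w)).erase ⟨0, hn⟩ := by
  simp only [rightStar, mem_filter, mem_univ, true_and] at hv
  ext w
  simp only [mem_erase, mem_filter, mem_univ, true_and, bipMinusStar_adj, bip_adj]
  constructor
  · rintro ⟨h1, h2⟩
    exact ⟨fun h => h2 (Or.inr ⟨by rw [h], hv.1, hv.2⟩), h1⟩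
  · rintro ⟨h1, h2⟩
    refine ⟨h2, fun h => ?_⟩
    rcases h with ⟨h3, _⟩ | ⟨h3, _⟩
    · omega
    · exact h1 (Fin.ext h3)

/-- The degrees of `bipMinusStar n a r`. -/
theorem deg_bipMinusStar (n a r : ℕ) (ha : 1 ≤ a) (har : a + r ≤ n) (v : Fin n) :
    deg (bipMinusStar n a r) v =
      if v.val = 0 then n - a - r else if v ∈ rightStar n a r then a - 1 else deg (bip n a) v := by
  have hn : 0 < n := by omega
  unfold deg
  by_cases h0 : v.val = 0
  · rw [if_pos h0, filter_adj_bipMinusStar_zero n a r ha v h0, card_sdiff_of_subset]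
    · have := deg_bip_of_lt n a (by omega) v (by omega)
      unfold deg at this
      rw [this, card_rightStar n a r har]
    · intro w hw
      simp only [rightStar, mem_filter, mem_univ, true_and] at hw
      rw [mem_filter, bip_adj]
      exact ⟨mem_univ _, Or.inl ⟨by omega, by omega⟩⟩
  · rw [if_neg h0]
    by_cases hv : v ∈ rightStar n a r
    · rw [if_pos hv, filter_adj_bipMinusStar_star n a r ha hn v hv, card_erase_of_mem]
      · have hv' := hv
        simp only [rightStar, mem_filter, mem_univ, true_and] at hv'
        have := deg_bip_of_not_lt n a (by omega) v (by omega)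
        unfold deg at this
        rw [this]
      · have hv' := hv
        simp only [rightStar, mem_filter, mem_univ, true_and] at hv'
        rw [mem_filter, bip_adj]
        exact ⟨mem_univ _, Or.inr ⟨by simp; omega, by omega⟩⟩
    · rw [if_neg hv, filter_adj_bipMinusStar_of_ne n a r v h0 hv]

end C047

end TriangleCap

end PercRepro
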